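import Summits.BirchSwinnertonDyer.BirchSwinnertonDyer.Theorems.SylvesterTwoHeegnerIndexUpperOffV0ModTwoImage
import Summits.BirchSwinnertonDyer.Rank1Residual.X11b.KolyvaginH44LocalizedCore
import Literature.NumberTheory.EllipticCurves.ComplexMultiplicationDeuring0Square
import Literature.NumberTheory.EllipticCurves.HuShuYin2019.SylvesterThreePart
import Literature.NumberTheory.GaloisRepresentations.HeckeCharacterProofs
import HarnessLib

/-!
# K7t crux `UpperOffV0HSYPlus` (item 19804), line `offv0-kolyvagin2`: the Kolyvagin primes of `E_p`
# at `2` are `≡ 2 (mod 3)`, hence SUPERSINGULAR (`a_ℓ(E_p) = 0`)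

Helper file of route `SylvesterTwoHeegnerIndex` (cell bsd-cm, rung K7t).  Discharges the labelled
input `hss` («`a_ℓ = 0` at every Kolyvagin prime of level `2^M`») of k7t-c2 g6's supersingular
`h44` chain (`…H44CoreSupersingular` … `…H44ConcreteSupersingular`) for the Sylvester curves:

* `mod_three_eq_two_of_frobEqFrobInfty_two` — for `W` any `ℚ`-model of a Mordell curve `y² = x³ − c`
  and a prime `ℓ ≠ 3` with Gross's condition (3.2) at `p = 2` (`FrobEqFrobInfty W K 2 ℓ`: an
  arithmetic Frobenius `h` at `𝔓 ∣ ℓ` acts on `E[2]` as a complex conjugation `c₀`): **`ℓ ≡ 2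
  (mod 3)`**.  Proof: `c₀ ω = ω⁻¹ = ω²` (`RatClosure.smul_eq_inv_of_pow_eq_one`); if `h ω = ω` then,
  comparing `h`, `c₀` on `[ω]T` through the Galois behaviour of `[ω]` on `E[2]` (k7t-c2 g3/g4's
  `exists_theta_two_torsion`: `σ[ω]T = [ω]σT` if `σω = ω`, `= [ω]²σT` if `σω = ω²`), `[ω] = [ω]²` on
  `E[2]`, whence `E[2] = 0` — absurd (`#E[2] = 4`); so `h ω = ω²`, and `h ω ≡ ω^ℓ (mod 𝔓)` gives
  `ω² − ω ∈ 𝔓` if `ℓ ≡ 1 (3)`, `(ω² − ω)² = −3 ∈ 𝔓 ∩ ℤ = (ℓ)`, `ℓ = 3`;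
* `frobeniusTrace_eq_zero_of_isKolyvaginPrime_two` — **`a_ℓ(W) = 0` for every Kolyvagin prime `ℓ`
  of `(W, K, 2)` at a level `N` with `3 ∣ N`**, `W` a globally minimal `ℚ`-model of `E_p` carrying a
  Heegner point of level `N` (`ℓ ∤ N` so `ℓ ≠ 3` and `W` has good reduction at `ℓ`; `j(W) = 0`;
  tree `frobeniusTrace_eq_zero_of_j_eq_zero_of_mod_three_eq_two`, Ireland–Rosen 18 §3 Thm. 4).

THEOREMS ONLY; no definition, no named fact, no `sorry`; B14 = O12 open as a class; BSD not claimed.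
References: [GrossLMS1991] §3 (3.2); [IrelandRosen1990] Ch. 18 §3 Thm. 4; [SilvermanAEC2009] III.1.4(b).
-/

set_option autoImplicit false
set_option linter.dupNamespace false

noncomputable section

open scoped Classical Pointwise
open WeierstrassCurve Field NumberField IsDedekindDomain
open Literature.NumberTheory.EllipticCurves Literature.NumberTheory.GaloisRepresentations
open Rat.HeightOneSpectrum
open Summit.BirchSwinnertonDyer.Rank1Residual.X11b.KolyvaginH44

namespace Summit.BirchSwinnertonDyer.BirchSwinnertonDyer.Theorems.SylvesterTwoUpper

/-! ## §1 `Frob(ℓ) = Frob(∞)` on `E[2]` forces `ℓ ≡ 2 (mod 3)` -/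

/-- **Gross's (3.2) at `p = 2` for a Mordell curve `y² = x³ − c` over `ℚ` forces `ℓ ≡ 2 (mod 3)`**
(`ℓ ≠ 3` a prime): an arithmetic Frobenius at a prime above `ℓ` acting on `E[2]` as a complex conjugation moves
`ω`, i.e. `ℓ` is inert in `ℚ(ω)`. [cite: GrossLMS1991, §3 (3.2)] -/
theorem mod_three_eq_two_of_frobEqFrobInfty_two (W : WeierstrassCurve ℚ) [W.IsElliptic]
    {C : VariableChange ℚ} {c : ℚ} (hCW : C • W = ⟨0, 0, 0, 0, -c⟩)
    {K : Type} [Field K] [NumberField K] {ℓ : ℕ} (hℓ : ℓ.Prime) (hℓ3 : ℓ ≠ 3)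
    (hfr : FrobEqFrobInfty W K 2 ℓ) : ℓ % 3 = 2 := by
  obtain ⟨v, 𝔓, h, c₀, hℓv, h𝔓, hh, hc₀, hE, -⟩ := hfr
  -- a primitive cube root of unity in `ℚ̄`
  obtain ⟨ω, hω⟩ : ∃ ω : AlgebraicClosure ℚ, ω ^ 2 + ω + 1 = 0 := by
    obtain ⟨ω, hω⟩ := IsAlgClosed.exists_root
      (Polynomial.X ^ 2 + Polynomial.X + 1 : Polynomial (AlgebraicClosure ℚ))
      (by rw [show (Polynomial.X ^ 2 + Polynomial.X + 1 : Polynomial (AlgebraicClosure ℚ)).degree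
        = 2 by compute_degree!]; norm_num)
    exact ⟨ω, by simpa [Polynomial.IsRoot] using hω⟩
  have hω3 : ω ^ 3 = 1 := by linear_combination (ω - 1) * hω
  have hω0 : ω ≠ 0 := by rintro rfl; norm_num at hω
  -- `c₀ ω = ω⁻¹ = ω²`
  have hc₀ω : c₀ • ω = ω ^ 2 := by
    rw [RatClosure.smul_eq_inv_of_pow_eq_one hc₀ (by norm_num) hω3]
    rw [inv_eq_of_mul_eq_one_right]
    rw [← pow_succ', hω3]
  -- `[ω]` on `E[2]` and its Galois behaviour
  obtain ⟨θ, hθrel, hθcomm, hθsemi, hcard, -⟩ := exists_theta_two_torsion W hCW hω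
  -- `h ω = ω²`
  have hhω : h • ω = ω ^ 2 := by
    rcases smul_omega_eq_or hω h with hfix | hmove
    · exfalso
      have key : ∀ S : geomTorsion W ((2 : ℕ) : ℤ), θ S = θ (θ S) := by
        intro S
        set T := c₀⁻¹ • S with hT
        have hS : c₀ • T = S := smul_inv_smul c₀ S
        have h1 := hθcomm h hfix T
        rw [hE (θ T), hE T, hS] at h1
        have h2 := hθsemi c₀ hc₀ω T
        rw [hS] at h2
        exact h1.symm.trans h2
      have hzero : ∀ S : geomTorsion W ((2 : ℕ) : ℤ), S = 0 := by
        intro S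
        have hrel := hθrel S
        rw [← key S] at hrel
        have h2 : (2 : ℤ) • θ S = 0 :=
          Subtype.ext (by exact_mod_cast (Submodule.mem_torsionBy_iff _ _).mp (θ S).2)
        rw [two_zsmul] at h2
        rwa [h2, zero_add] at hrel
      haveI : Subsingleton (geomTorsion W ((2 : ℕ) : ℤ)) :=
        ⟨fun a b => by rw [hzero a, hzero b]⟩
      have h1 : Nat.card (geomTorsion W ((2 : ℕ) : ℤ)) = 1 :=
        Nat.card_of_subsingleton (0 : geomTorsion W ((2 : ℕ) : ℤ))
      rw [h1] at hcard
      norm_num at hcard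
    · exact hmove
  -- the Frobenius congruence `h ω ≡ ω^ℓ (mod 𝔓)` on `ℤ̄`
  have hωint : IsIntegral (𝓞 ℚ) ω :=
    IsIntegral.of_pow (by norm_num : 0 < 3) (by rw [hω3]; exact isIntegral_one)
  set x : absIntegers (𝓞 ℚ) ℚ := ⟨ω, hωint⟩ with hx
  have hq : v.residueCard = ℓ := by
    rw [Rat.residueCard_eq_natGenerator]; exact Rat.natGenerator_eq_of_natCast_mem hℓ hℓv
  have hfrob : h • x - x ^ ℓ ∈ 𝔓 := by
    have := (HeightOneSpectrum.isArithFrobAt_iff_of_mem_primesAbove h𝔓 h).mp hh x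
    rwa [hq] at this
  -- case analysis on `ℓ mod 3`
  have hcases : ℓ % 3 = 0 ∨ ℓ % 3 = 1 ∨ ℓ % 3 = 2 := by omega
  rcases hcases with h0 | h1 | h2
  · exact absurd ((Nat.prime_dvd_prime_iff_eq Nat.prime_three hℓ).mp
      (Nat.dvd_of_mod_eq_zero h0)).symm hℓ3
  · exfalso
    -- `ω^ℓ = ω`, so `y := ω² − ω ∈ 𝔓` and `y² = −3 ∈ 𝔓`
    have hωℓ : ω ^ ℓ = ω := by
      rw [← Nat.div_add_mod ℓ 3, h1, pow_add, pow_mul, hω3, one_pow, one_mul, pow_one]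
    have hy : ((h • x - x ^ ℓ : absIntegers (𝓞 ℚ) ℚ) : AlgebraicClosure ℚ) = ω ^ 2 - ω := by
      simp only [hx, Subalgebra.coe_sub, Subalgebra.coe_pow, integralClosure.coe_smul, hhω, hωℓ]
    have h3 : (h • x - x ^ ℓ) * (h • x - x ^ ℓ) + ((3 : ℕ) : absIntegers (𝓞 ℚ) ℚ) = 0 := by
      apply Subtype.ext
      rw [Subalgebra.coe_add, Subalgebra.coe_mul, hy, SubringClass.coe_natCast,
        ZeroMemClass.coe_zero]
      push_cast
      linear_combination (ω ^ 2 - 3 * ω + 3) * hω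
    have h3mem : ((3 : ℕ) : absIntegers (𝓞 ℚ) ℚ) ∈ 𝔓 := by
      have hzz := 𝔓.mul_mem_left (h • x - x ^ ℓ) hfrob
      rw [eq_neg_of_add_eq_zero_right h3]
      exact 𝔓.neg_mem hzz
    -- so `3 ∈ 𝔓 ∩ 𝓞 ℚ = v`, and `v = (ℓ)`: `ℓ = 3`
    haveI := h𝔓.1
    have h3v : ((3 : ℕ) : 𝓞 ℚ) ∈ v.asIdeal := by
      rw [h𝔓.2.over, Ideal.under_def, Ideal.mem_comap, map_natCast]
      exact_mod_cast h3mem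
    have := (Rat.natGenerator_eq_of_natCast_mem Nat.prime_three h3v).symm.trans
      (Rat.natGenerator_eq_of_natCast_mem hℓ hℓv)
    exact hℓ3 this.symm
  · exact h2

/-! ## §2 `a_ℓ(E_p) = 0` at every Kolyvagin prime of `(E_p, K, 2)` -/

/-- **The Kolyvagin primes of the Sylvester curves at `2` are supersingular**: for `W` a globally
minimal (elliptic) `ℚ`-model of `E_p : y² = x³ − 432p²` carrying a Heegner point of level `N` over `K`, with
`3 ∣ N`, and `ℓ` a Kolyvagin prime of `(W, K, 2)` at level `N`: `a_ℓ(W) = 0` (`ℓ ∤ N ∋ 3`; `ℓ ≡ 2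
(mod 3)` by `mod_three_eq_two_of_frobEqFrobInfty_two`; `j(W) = 0`; good reduction at `ℓ ∤ N`;
Ireland–Rosen: `N_ℓ = ℓ + 1`). [cite: IrelandRosen1990, Ch. 18 §3, Theorem 4] [cite: GrossLMS1991, §3 (3.1)–(3.2)] -/
theorem frobeniusTrace_eq_zero_of_isKolyvaginPrime_two {N : ℕ} [NeZero N] (W : WeierstrassCurve ℚ)
    [W.IsElliptic] [W.IsGloballyMinimal] {p : ℕ}
    (hW : ∃ C : VariableChange ℚ, C • W = HuShuYin2019.cubeSumCurve (p : ℚ)) (h3N : 3 ∣ N)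
    {K : Type} [Field K] [NumberField K] {P : (W.baseChange K).toAffine.Point}
    (hHP : IsHeegnerPoint N W K P) {ℓ : ℕ} (hℓ : IsKolyvaginPrime N W K 2 ℓ) :
    W.frobeniusTrace ℓ = 0 := by
  haveI : Fact ℓ.Prime := ⟨hℓ.prime⟩
  have hℓ3 : ℓ ≠ 3 := fun h ↦ hℓ.2.1 (h ▸ h3N)
  -- the Mordell model `C • W = y² = x³ − 432p²`
  obtain ⟨C, hCW⟩ := hW
  have hCW' : C • W = ⟨0, 0, 0, 0, -(432 * (p : ℚ) ^ 2)⟩ := by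
    rw [hCW, HuShuYin2019.cubeSumCurve]; congr 1; ring
  have h32 : ℓ % 3 = 2 :=
    mod_three_eq_two_of_frobEqFrobInfty_two W hCW' hℓ.prime hℓ3 hℓ.2.2.2.2.2
  -- `j(W) = 0`
  have hc4 : (C • W).c₄ = 0 := by
    rw [hCW']; simp [WeierstrassCurve.c₄, WeierstrassCurve.b₂, WeierstrassCurve.b₄]
  have hj : W.j = 0 := by
    rw [← W.variableChange_j C, WeierstrassCurve.j, hc4]; simp
  -- good reduction at `ℓ ∤ N`
  obtain ⟨v₀, hv₀, hℓv₀⟩ := exists_ratPlace ℓ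
  have hgood₀ : W.HasGoodReductionAt v₀ := hℓ.hasGoodReductionAt_rat hHP v₀ hℓv₀
  have hΔ : ¬ (ℓ : ℤ) ∣ minimalDiscriminantInt W := by
    have h1 := (hasGoodReductionAtPrime_iff_hasGoodReductionAt_ringOfIntegers v₀ W).mpr hgood₀
    have h2 := @not_dvd_minimalDiscriminantInt_of_hasGoodReductionAtPrime' W _
      (primesEquiv v₀ : ℕ) (Fact.mk (primesEquiv v₀).2) h1
    rwa [hv₀] at h2
  exact frobeniusTrace_eq_zero_of_j_eq_zero_of_mod_three_eq_two W hj hℓ.prime h32 hℓ.2.2.2.1 hΔ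

end Summit.BirchSwinnertonDyer.BirchSwinnertonDyer.Theorems.SylvesterTwoUpper

end
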